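import Mathlib
import HarnessLib
import Literature.Geometry.DiscreteGeometry.SphericalCodeHullEulerFormula
import Literature.Geometry.DiscreteGeometry.KissingPatterns
import Literature.Geometry.DiscreteGeometry.KissingRigidity

/-!
# Soft four-rings: the endgame-rigidity statement (definition)

Route `PricedLinkCensus`, sub-problem `Crystallization`, item `SoftFourRings`
(stmt-AtomisticToContinuum-14234).  This file only DEFINES the proposition
`EndgameRigidity δ`, the remaining (metric) half of the proof of `SoftFourRings`:

  `SoftFourRings ⇐ musinTarasov2012_tammes_thirteen ∧ EndgameRigidity (6/25)`

(`softFourRings_of_endgameRigidity` in `PricedLinkCensusSoftFourRingsAssembly`).  The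
combinatorial half is proved in the tree (`no_slack_one_percent`: in the hull-level setting of
the twelve-point reduction, conditional on Tammes-13, there are exactly `8` bond triangles and
every vertex lies in exactly `2` of them).

**Statement.**  Twelve unit vectors `X ⊂ S²`, pairwise at cosine `≤ 1 − 1/(2·1.01²)`, with a
family `B` of `24` *bonds* (pairs at cosine `≥ 1 − 1.01²/2`), four at every point, non-bonded
pairs at cosine `< 1.01/2`, `0 ∈ interior (conv X)`, all facets triangles or quadrilaterals,
exactly `8` bond-triangle facets and every point in exactly `2` of them — THEN some rotate of
the cuboctahedral (`fccKissingPattern`) or anticuboctahedral (`hcpKissingPattern`) kissing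
pattern has every pattern point within `δ` of a point of `X`.

**Status / evidence.**  Believed true with margin about `2`: a complete numerical search over
the hull structures forced by the hypotheses (bond graph = cuboctahedron or anticuboctahedron
graph, `8` triangles and `6` quadrilateral cells) finds maximal deviation `0.098` (fcc) and
`0.128` (hcp) after optimal rotation at tolerance one percent (item evidence
`softrings-search.md`, sections 4 and 12).  The obstruction to a short proof is that both
frameworks are first-order flexible on the sphere (jitterbug / cupola twist), so the deviation
is of order `√η` and a proof needs a global second-order (prestress) rigidity estimate sharp
within a factor about `2`; aligning the rotation to a single bond instead of optimally already
costs the whole margin (deviation `0.22`–`0.25`).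
-/

namespace Summit.AtomisticToContinuum.Crystallization.Theorems

open Real RealInnerProductSpace Literature.Geometry.DiscreteGeometry

open scoped Classical in
/-- **Endgame rigidity at one percent, with matching radius `δ`** (route-posited claim, the
metric half of `SoftFourRings`; used at `δ = 6/25`; see the module docstring): in the
hull-level setting of the twelve-point reduction with `8` bond triangles and two of them at
every vertex, a rotated fcc or hcp kissing pattern is matched within `δ`. -/
def EndgameRigidity (δ : ℝ) : Prop :=
  ∀ (X : Finset (EuclideanSpace ℝ (Fin 3))) (B : Finset (Finset (EuclideanSpace ℝ (Fin 3)))),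
    (∀ y ∈ X, ‖y‖ = 1) → X.card = 12 →
    (∀ u ∈ X, ∀ u' ∈ X, u ≠ u' → ⟪u, u'⟫ ≤ 1 - 1 / (2 * (101 / 100 : ℝ) ^ 2)) →
    (∀ T ∈ B, ∃ u ∈ X, ∃ u' ∈ X, u ≠ u' ∧ 1 - (101 / 100 : ℝ) ^ 2 / 2 ≤ ⟪u, u'⟫ ∧
      T = {u, u'}) →
    B.card = 24 →
    (∀ v ∈ X, ∃ w : Fin 4 → EuclideanSpace ℝ (Fin 3), (∀ k, w k ∈ X) ∧
      Function.Injective w ∧ (∀ k, w k ≠ v) ∧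
      (∀ k, ({v, w k} : Finset (EuclideanSpace ℝ (Fin 3))) ∈ B) ∧
      ∀ y, ({v, y} : Finset (EuclideanSpace ℝ (Fin 3))) ∈ B → ∃ k, y = w k) →
    (∀ u ∈ X, ∀ u' ∈ X, u ≠ u' → ({u, u'} : Finset (EuclideanSpace ℝ (Fin 3))) ∉ B →
      ⟪u, u'⟫ < 101 / 200) →
    (0 : EuclideanSpace ℝ (Fin 3)) ∈ interior (convexHull ℝ (X : Set (EuclideanSpace ℝ (Fin 3)))) →
    (∀ c ∈ facetNormals X, (tightSet X c).card = 3 ∨ (tightSet X c).card = 4) →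
    ((facetNormals X).filter (fun c => (tightSet X c).card = 3 ∧
      ((edgesOfFacet X c).filter (fun T => T ∉ B)).card = 0)).card = 8 →
    (∀ v ∈ X, ((facetNormals X).filter (fun c => v ∈ tightSet X c ∧ (tightSet X c).card = 3 ∧
        ((edgesOfFacet X c).filter (fun T => T ∉ B)).card = 0)).card = 2) →
    ∃ (A : EuclideanSpace ℝ (Fin 3) →ₗᵢ[ℝ] EuclideanSpace ℝ (Fin 3)) (P : Finset (EuclideanSpace ℝ (Fin 3))),
      (P = fccKissingPattern ∨ P = hcpKissingPattern) ∧
      ∀ p ∈ P, ∃ x ∈ X, dist x (A p) ≤ δ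


/-- **Labelled rigidity at one percent, with matching radius `δ`** (route-posited claim: the
purely METRIC half of `EndgameRigidity`; see `endgameRigidity_of_labelledRigidity` in
`PricedLinkCensusSoftFourRingsEndgameReduction`).  Twelve unit vectors `p 0, …, p 11`, pairwise at
cosine `≤ 1 − 1/(2·1.01²)`, whose pairs at cosine `≥ 1 − 1.01²/2` ("bonds") are EXACTLY the FCC
contact pairs `fccAdj i j` of `Literature/…/KissingRigidity` (cuboctahedron) — respectively the
HCP contact pairs `hcpAdj i j` (anticuboctahedron) — and whose other pairs are at cosine
`< 1.01/2`, admit a linear isometry `A` of `ℝ³` putting every point of the rotated kissing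
pattern `A '' fccKissingPattern` (resp. `A '' hcpKissingPattern`) within `δ` of some `p i`.
(The intended matching is `i ↦ A ((√2)⁻¹ • intVec (fccTab i))`, resp.
`A ((√18)⁻¹ • intVec (hcpTab i))`.)  Numerically the optimal deviation at one percent is
`0.098` (FCC) / `0.128` (HCP), attained by jitterbug-type twists; explicit frames built from bond
triangle centres achieve `0.10` / `0.13` (item evidence `softrings-search.md` §4, §12.7). -/
def LabelledRigidity (δ : ℝ) : Prop :=
  (∀ p : Fin 12 → EuclideanSpace ℝ (Fin 3), (∀ i, ‖p i‖ = 1) →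
    (∀ i j, i ≠ j → ⟪p i, p j⟫ ≤ 1 - 1 / (2 * (101 / 100 : ℝ) ^ 2)) →
    (∀ i j, fccAdj i j → 1 - (101 / 100 : ℝ) ^ 2 / 2 ≤ ⟪p i, p j⟫) →
    (∀ i j, i ≠ j → ¬ fccAdj i j → ⟪p i, p j⟫ < 101 / 200) →
    ∃ A : EuclideanSpace ℝ (Fin 3) →ₗᵢ[ℝ] EuclideanSpace ℝ (Fin 3), ∀ q ∈ fccKissingPattern, ∃ i, dist (p i) (A q) ≤ δ) ∧
  (∀ p : Fin 12 → EuclideanSpace ℝ (Fin 3), (∀ i, ‖p i‖ = 1) →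
    (∀ i j, i ≠ j → ⟪p i, p j⟫ ≤ 1 - 1 / (2 * (101 / 100 : ℝ) ^ 2)) →
    (∀ i j, hcpAdj i j → 1 - (101 / 100 : ℝ) ^ 2 / 2 ≤ ⟪p i, p j⟫) →
    (∀ i j, i ≠ j → ¬ hcpAdj i j → ⟪p i, p j⟫ < 101 / 200) →
    ∃ A : EuclideanSpace ℝ (Fin 3) →ₗᵢ[ℝ] EuclideanSpace ℝ (Fin 3), ∀ q ∈ hcpKissingPattern, ∃ i, dist (p i) (A q) ≤ δ)

end Summit.AtomisticToContinuum.Crystallization.Theorems
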